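import Summits.BirchSwinnertonDyer.Rank1Residual.Additive.KatoDescentTorsionFree
import Literature.NumberTheory.EllipticCurves.Kato2004.PerrinRiouRatio
import HarnessLib

/-!
# The node PR^× = `PerrinRiouUpToUnitAt` over the CONSTRUCTED ratio predicate `Kato2004.PRRatio`
# (part 5′ of the descent files of cell `bsd-potss`; cell `bsd-cm`, seat `bsd-cm-prr-ty1`, row (M2) of
# planner D347): the closed node spelled out, its emptiness at `p = 2`, and part 8b's torsion-free descent
# `KMC ∧ PR^× ⇒ BSD_p` / `KMC ∧ BSD_p ⇒ PR^×` with the binder `PRRatio` INSTANTIATED (theorems only)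

HONEST FRAMING: theorems BY NAME over parts 5 / 8a / 8b (`KatoDescentRankOnePerrinRiou`,
`KatoDescentTorsionFreeReadings`, `KatoDescentTorsionFree`) with the interface binder `PRRatio`
instantiated at the Literature definition `Literature.NumberTheory.EllipticCurves.Kato2004.PRRatio`
(`Kato2004/PerrinRiouRatio.lean`: «`ℒ` is the Perrin-Riou ratio `log_ω(loc_p z†)·(Ω⁺_f/Ω_W)/(∏P_ℓ(ℓ⁻¹)·log_ω(x)²)`
of a VALUE-PINNED Kato zeta datum of `(W,p)`» — W2's `DefinedExpStarBody` with Tate-duality normalised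
generator, rational constant divided out, potss's cusp/depletion calibration, rkm's Λ-adic pin, cn100's
`HasLocPKummerLog`). With it the node `PerrinRiouUpToUnitAt Kato2004.PRRatio W p` is a CLOSED `Prop` for every
`(W, p)` — Burns–Kurihara–Sano Conj. 2.8 (ii) (= Perrin-Riou 1993 §3.3) up to a `p`-adic unit, in the tree's
`Ω_W`-currency — so that a research stub `∀ W ∈ 𝒞, PerrinRiouUpToUnitAt Kato2004.PRRatio W p` is SOUND (no
open binder; planner D136/D137's junk audit: `⊥` and `(· = 1)` are not instances). The readings
`TorsionFree.RankOneCountReading IsOf Kato2004.PRRatio`, `TorsionFree.HasPRRatio Kato2004.PRRatio` keep their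
status of displayed PRINT inputs (Kato Thm. 12.4/12.5, 9.7, 6.6 (1), (14.9.3), Prop. 14.21–22; BKS Thm. 7.3 /
7.8 (d); BK90 Prop. 3.8; the modular parametrisation) — now statements about a DEFINED object; `IsOf` and
`KMC` remain binders. NOTHING about Perrin-Riou's conjecture, Kato's Main Conjecture or BSD is asserted; no
definition, no named fact, no instance; no item is closed; BSD is not proved for any curve by any of this.
AT `p = 2` the predicate is EMPTY by design (`Kato2004.not_prRatio_two`), so the closed node degenerates to
`r_an ≠ 1` there (§1): it must not be instantiated at `2` (no consumer does: K7r is `p = 7`, K8 is `p ≥ 5`,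
potss is `p` odd).

References: B. Perrin-Riou, Ann. Inst. Fourier 43 (1993) §3.3 [PerrinRiou1993AIF]; D. Burns, M. Kurihara,
T. Sano, arXiv:1910.07404, Thm. 1.4 (p. 4), Conj. 2.8 (p. 10), Thm. 7.3 / 7.6 (p. 29) [BurnsKuriharaSano2019];
K. Kato, Astérisque 295 (2004) Conj. 12.10 (p. 224), §14.14 (p. 243) [Kato2004Asterisque]; R. L. Miller,
LMS JCM 14 (2011) Def. 1.1 [Miller2011LMS].
-/

set_option autoImplicit false

noncomputable section

open scoped Classical

open WeierstrassCurve Literature.NumberTheory.EllipticCurves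
  Literature.NumberTheory.EllipticCurves.Rank1Residual
  Literature.NumberTheory.EllipticCurves.Rank1Residual.Typed
  Literature.NumberTheory.EllipticCurves.IwasawaAlgebra

namespace Summit.BirchSwinnertonDyer.Rank1Residual.Additive

/-! ## §1 The closed node, spelled out; emptiness at `p = 2` -/

/-- **The node over the constructed predicate, unfolded**: `PerrinRiouUpToUnitAt Kato2004.PRRatio W p` says
— in analytic rank one — that SOME value-pinned Kato zeta datum of `(W,p)` has a non-zero Perrin-Riou ratio
`ℒ` with `v_p ℒ = v_p(L′(W,1)/(Ω_W·Reg W))` (definitional unfolding; the three `ℤ_p`-structure facts of `T_pW`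
inside `Kato2004.PRRatio` are supplied by the tree theorems). [cite: BurnsKuriharaSano2019, Conj. 2.8 (ii) (p. 10) and Thm. 1.4 (p. 4)]
[cite: PerrinRiou1993AIF, §3.3] -/
theorem perrinRiouUpToUnitAt_prRatio_iff (W : WeierstrassCurve ℚ) [W.IsElliptic] [W.IsGloballyMinimal]
    (p : ℕ) [Fact p.Prime] :
    PerrinRiouUpToUnitAt Kato2004.PRRatio W p ↔
      (W.analyticRank = 1 →
        ∃ ℒ : ℚ_[p], Kato2004.PRRatio W p ℒ ∧ ℒ ≠ 0 ∧
          ∃ q : ℚ, W.leadingLCoeff / ((W.realPeriodRat : ℂ) * (W.regulator : ℂ)) = (q : ℂ) ∧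
            ℒ.valuation = padicValRat p q) :=
  Iff.rfl

/-- **At `p = 2` the closed node is NOT Perrin-Riou's conjecture**: the predicate `Kato2004.PRRatio W 2` is
empty by design (`Kato2004.not_prRatio_two`), so `PerrinRiouUpToUnitAt Kato2004.PRRatio W 2` FAILS at every
curve of analytic rank one. Recorded so that no skeleton instantiates the node at `2`.
[cite: Kato2004Asterisque, Thm. 12.5 (4) (p. 222) (`p ≠ 2`)] -/
theorem not_perrinRiouUpToUnitAt_prRatio_two (W : WeierstrassCurve ℚ) [W.IsElliptic] [W.IsGloballyMinimal]
    [Fact (Nat.Prime 2)] (hr : W.analyticRank = 1) : ¬ PerrinRiouUpToUnitAt Kato2004.PRRatio W 2 := by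
  intro h
  obtain ⟨ℒ, hℒ, -⟩ := h hr
  exact Kato2004.not_prRatio_two W ℒ hℒ

/-- The node over the constructed predicate, when it yields a ratio, forces `p ≠ 2`.
[cite: Kato2004Asterisque, Thm. 12.5 (4) (p. 222) (`p ≠ 2`)] -/
theorem ne_two_of_perrinRiouUpToUnitAt_prRatio (W : WeierstrassCurve ℚ) [W.IsElliptic] [W.IsGloballyMinimal]
    (p : ℕ) [Fact p.Prime] (hr : W.analyticRank = 1) (h : PerrinRiouUpToUnitAt Kato2004.PRRatio W p) :
    p ≠ 2 := by
  obtain ⟨ℒ, hℒ, -⟩ := h hr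
  exact Kato2004.ne_two_of_prRatio hℒ

/-! ## §2 Part 8b's torsion-free descent with the ratio predicate INSTANTIATED (by name) -/

namespace TorsionFree

section Descent

variable {IsOf : ∀ (W : WeierstrassCurve ℚ) [W.IsElliptic] [W.IsGloballyMinimal] (p : ℕ) [Fact p.Prime],
  KatoDescentDatum p → Prop}
variable {KMC : ∀ (W : WeierstrassCurve ℚ) [W.IsElliptic] [W.IsGloballyMinimal] (p : ℕ), Prop}
variable (W : WeierstrassCurve ℚ) [W.IsElliptic] [W.IsGloballyMinimal] (p : ℕ) [Fact p.Prime]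

/-- **KMC(T_pW) ∧ PR^×(W,p) over `Kato2004.PRRatio` ⇒ `MissingPPartAt W p`** at a torsion-free rank-one
member (`p ≠ 2` additive potentially good, `p ∤ #W(ℚ)_tors`; ANY image) — part 8b's
`rankOne_missingPPartAt_of_kmc_of_perrinRiou` (Burns–Kurihara–Sano Thm. 7.6 at `r = 1` in Kato's
`𝐇²`-formalism) with `PRRatio := Kato2004.PRRatio`. CONDITIONAL on the displayed readings, GZK, modularity,
KMC and the closed node; nothing booked. [cite: BurnsKuriharaSano2019, Thm. 7.6 and Remark 7.7 (p. 29)]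
[cite: Kato2004Asterisque, Conj. 12.10 (p. 224), §14.14 (p. 243)] -/
theorem rankOne_missingPPartAt_of_kmc_of_perrinRiouRatio
    (hC : RankOneCountReading IsOf Kato2004.PRRatio) (hreal : RealizableOfKMC IsOf KMC)
    (hread : ReadsTrivialKMC IsOf KMC) (hGZK : rank_eq_analyticRank_of_analyticRank_le_one)
    (hmod : hasEntireLFunction_rat) (hr : W.analyticRank = 1) (hp : p ≠ 2) (hadd : Addv W p)
    (hj : 0 ≤ padicValRat p W.j) (ht : ¬ p ∣ W.torsionOrder)
    (hPR : PerrinRiouUpToUnitAt Kato2004.PRRatio W p) (hKMC : KMC W p) : MissingPPartAt W p :=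
  rankOne_missingPPartAt_of_kmc_of_perrinRiou W p hC hreal hread hGZK hmod hr hp hadd hj ht hPR hKMC

/-- **… and `BSD(W,p)`** (analytic rank `≤ 1`; PR^× over `Kato2004.PRRatio` needed only in rank one) — part
8b's `bsdp_of_kmc_of_perrinRiou` with `PRRatio := Kato2004.PRRatio`. CONDITIONAL; nothing booked.
[cite: Kato2004Asterisque, Conj. 12.10 (p. 224)] [cite: Miller2011LMS, Def. 1.1] -/
theorem bsdp_of_kmc_of_perrinRiouRatio (hR : DescentCountReading IsOf)
    (hC : RankOneCountReading IsOf Kato2004.PRRatio) (hreal : RealizableOfKMC IsOf KMC)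
    (hread : ReadsTrivialKMC IsOf KMC) (hGZK : rank_eq_analyticRank_of_analyticRank_le_one)
    (hmod : hasEntireLFunction_rat) (hr : W.analyticRank ≤ 1) (hp : p ≠ 2) (hadd : Addv W p)
    (hj : 0 ≤ padicValRat p W.j) (ht : ¬ p ∣ W.torsionOrder)
    (hPR : W.analyticRank = 1 → PerrinRiouUpToUnitAt Kato2004.PRRatio W p) (hKMC : KMC W p) :
    BSDp W p :=
  bsdp_of_kmc_of_perrinRiou W p hR hC hreal hread hGZK hmod hr hp hadd hj ht hPR hKMC

/-- **Conversely (BKS Thm. 7.3 at `r = 1`): KMC(T_pW) ∧ `MissingPPartAt W p` ⇒ PR^×(W,p) over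
`Kato2004.PRRatio`** at a torsion-free rank-one member — part 8b's
`perrinRiouUpToUnitAt_of_kmc_of_missingPPartAt` with `PRRatio := Kato2004.PRRatio`; the realisability
reading `HasPRRatio Kato2004.PRRatio` (PRINT: Kato's Euler system with defined dual exponential, Tate duality,
the modular parametrisation, rkm's lift, `H¹(ℤ[1/p],V) = H¹_f` in rank one, Mordell–Weil — module docstring of
`Kato2004/PerrinRiouRatio.lean`) supplies the datum. CONDITIONAL; nothing booked.
[cite: BurnsKuriharaSano2019, Thm. 7.3 (p. 29) and Thm. 7.8 (d) (p. 30)] [cite: Kato2004Asterisque, Conj. 12.10 (p. 224)] -/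
theorem perrinRiouRatio_of_kmc_of_missingPPartAt (hC : RankOneCountReading IsOf Kato2004.PRRatio)
    (hrat : HasPRRatio Kato2004.PRRatio) (hreal : RealizableOfKMC IsOf KMC)
    (hread : ReadsTrivialKMC IsOf KMC) (hGZK : rank_eq_analyticRank_of_analyticRank_le_one)
    (hmod : hasEntireLFunction_rat) (hr : W.analyticRank = 1) (hp : p ≠ 2) (hadd : Addv W p)
    (hj : 0 ≤ padicValRat p W.j) (ht : ¬ p ∣ W.torsionOrder) (hKMC : KMC W p)
    (hbsd : MissingPPartAt W p) : PerrinRiouUpToUnitAt Kato2004.PRRatio W p :=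
  perrinRiouUpToUnitAt_of_kmc_of_missingPPartAt W p hC hrat hreal hread hGZK hmod hr hp hadd hj ht hKMC
    hbsd

end Descent

end TorsionFree

end Summit.BirchSwinnertonDyer.Rank1Residual.Additive

end
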